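import Summits.Ventures.PercRepro.C041ZoneZF

/-!
# The ZONE O-CUBE (mine-3's C-041.md §14 (a)) on the abstract zone — the statement (p6, gen 27)

Setting of `C041ZoneZF`.  On the abstract zone the side-`2` deleted set `D2` is the blue reach of the `2`-blockers
`M`, `REACH2` the red reach of the anchors outside `D2` inside the non-deleted vertices; `G1` = a red `2`-edge at
`REACH` (= `¬ reach2`), `G2` = a red `1`-edge at `REACH2`, `Valid` = a red terminal edge at `K` (= `¬ blueK`); the
WEIGHT of a state is `[valid]·(3·[G1] + 3·[G2] − 2)` (`ocWeight`), the ZONE O-CUBE SUM is its sum over the admissible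
states with `Γ` (`zoneOCube`; with `Forced` on a zone with forced edges, `zoneOCubeF`), and mine-3's CONJECTURE
(ZONE O-CUBE) is `0 ≤ zoneOCube` (`ZoneOCubeConj`, `ZoneOCubeConjF`) — the (O-CUBE) of the skeleton «a red hub
joining the probe to the anchors, one terminal-adjacent zone»; THEOREM R is its singleton case (not typed here).
Proved: `G1` and `G2` imply `Valid` (`valid_of_G1`, `valid_of_G2`: `REACH ⊆ K`, `REACH2 ⊆ K`), so the weight is
`3·[G1] + 3·[G2] − 2·[valid]` (`ocWeight_eq`).  NOT claimed: the conjecture itself (census C-041.md §14 (a): 391 + 231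
instances, 0 negative).
-/

namespace PercRepro

namespace ZoneZ

namespace ZoneData

open Finset

variable {V E T₁ T₂ : Type*} (Z : ZoneData V E T₁ T₂) (A : Set V)

/-- `D2`: the deleted vertices on side `2` (the blue reach of the `2`-blockers). -/
def D2 (σ : State E T₁ T₂) : Set V := reach (Z.BlueAdj σ) (Z.M σ)

/-- `REACH2`: the red reach of the anchors not deleted on side `2`, inside the non-deleted vertices. -/
def REACH2 (σ : State E T₁ T₂) : Set V := reachIn (Z.RedAdj σ) (Z.D2 σ)ᶜ A

/-- `G1`: a red `2`-edge at a vertex of `REACH`. -/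
def G1 (σ : State E T₁ T₂) : Prop := (Z.REACH A σ ∩ Z.Mt σ).Nonempty

/-- `G2`: a red `1`-edge at a vertex of `REACH2`. -/
def G2 (σ : State E T₁ T₂) : Prop := (Z.REACH2 A σ ∩ Z.Blt σ).Nonempty

/-- Valid: a red terminal edge at a vertex of `K`. -/
def Valid (σ : State E T₁ T₂) : Prop := ¬ Z.blueK A σ

/-- `REACH2 ⊆ K`. -/
theorem REACH2_subset_K (σ : State E T₁ T₂) : Z.REACH2 A σ ⊆ Z.K A σ := reachIn_subset_reach

/-- `G1` implies validity. -/
theorem valid_of_G1 {σ : State E T₁ T₂} (h : Z.G1 A σ) : Z.Valid A σ := by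
  obtain ⟨v, hvR, hvM⟩ := h
  intro hK
  exact Set.disjoint_left.1 hK (Z.REACH_subset_K A σ hvR) (Or.inr hvM)

/-- `G2` implies validity. -/
theorem valid_of_G2 {σ : State E T₁ T₂} (h : Z.G2 A σ) : Z.Valid A σ := by
  obtain ⟨v, hvR, hvB⟩ := h
  intro hK
  exact Set.disjoint_left.1 hK (Z.REACH2_subset_K A σ hvR) (Or.inl hvB)

open Classical in
/-- The weight of a state: `[valid]·(3·[G1] + 3·[G2] − 2)`. -/
noncomputable def ocWeight (σ : State E T₁ T₂) : ℤ :=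
  if Z.Valid A σ then 3 * (if Z.G1 A σ then 1 else 0) + 3 * (if Z.G2 A σ then 1 else 0) - 2 else 0

open Classical in
/-- The weight is `3·[G1] + 3·[G2] − 2·[valid]`, because `G1` and `G2` force validity. -/
theorem ocWeight_eq (σ : State E T₁ T₂) :
    Z.ocWeight A σ = 3 * (if Z.G1 A σ then 1 else 0) + 3 * (if Z.G2 A σ then 1 else 0) -
      2 * (if Z.Valid A σ then 1 else 0) := by
  unfold ocWeight
  by_cases hv : Z.Valid A σ
  · rw [if_pos hv, if_pos hv]
    ring
  · rw [if_neg hv, if_neg hv, if_neg (fun h => hv (Z.valid_of_G1 A h)), if_neg (fun h => hv (Z.valid_of_G2 A h))]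
    ring

section Sums

variable [Fintype E] [DecidableEq E] [Fintype T₁] [DecidableEq T₁] [Fintype T₂] [DecidableEq T₂] (Q : Set V)

open Classical in
/-- The admissible states with `Γ`. -/
noncomputable def Aset : Finset (State E T₁ T₂) := univ.filter fun σ => Z.adm σ ∧ Z.Gam Q σ

/-- The ZONE O-CUBE sum over the admissible states with `Γ`. -/
noncomputable def zoneOCube : ℤ := ∑ σ ∈ Z.Aset Q, Z.ocWeight A σ

/-- **mine-3's CONJECTURE (ZONE O-CUBE)** (C-041.md §14 (a)): the weighted sum over the admissible states of a zone is
nonnegative.  NOT asserted. -/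
def ZoneOCubeConj : Prop := 0 ≤ Z.zoneOCube A Q

end Sums

end ZoneData

namespace FZone

open Finset

variable {V E T₁ T₂ : Type*} (F : FZone V E T₁ T₂) (A : Set V)
variable [Fintype E] [DecidableEq E] [Fintype T₁] [DecidableEq T₁] [Fintype T₂] [DecidableEq T₂] (Q : Set V)

open Classical in
/-- The forced admissible states with `Γ` of a zone with forced edges. -/
noncomputable def AsetF : Finset (State E T₁ T₂) := univ.filter fun σ => F.Forced σ ∧ F.adm σ ∧ F.Gam Q σ

/-- The ZONE O-CUBE sum on a zone with forced edges. -/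
noncomputable def zoneOCubeF : ℤ := ∑ σ ∈ F.AsetF Q, F.ocWeight A σ

/-- CONJECTURE (ZONE O-CUBE) with forced edges.  NOT asserted. -/
def ZoneOCubeConjF : Prop := 0 ≤ F.zoneOCubeF A Q

end FZone

end ZoneZ

end PercRepro
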